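import Mathlib
import HarnessLib
import HarnessLib.Audit
import Summits.AtomisticToContinuum.Statement

/-!
Route: BurgersZoomLadder

# Route BurgersZoomLadder — the Euler zoom puts the conjunct and the Burgers sound window on one
diagonal ladder; climb it from the window, where closure is NS-sharp, scalar and crosses the shock

It suffices to show X = ZoomUniformLimit (LADDER TOP; card burgers-window-through-the-shock realised
as its floor; conforming D-0027 §2.1
successor of the retired milestone route BurgersWindow). X: for all continuous positive profiles
(a₀, u₀, θ₀), base temperature θe > 0 and
floor exponent γ ∈ (0, 1/3) there is σ₀ > 0 such that for σ ∈ (0, σ₀), every horizon τ > 0, every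
family of classical hard-sphere Euler
solutions (ρ^d, u^d, θ^d) on [0, T(d)), d ∈ (0, 1], all hard-sphere flows and EVERY amplitude
sequence (N+1)^(−γ) ≤ δ_N ≤ 1: under the
local Gibbs laws with the power-path profiles (a₀^δ_N, δ_N u₀, θe^(1−δ_N) θ₀^δ_N) (the exact-tilt
family of route CramerEdgeLadder: global
equilibrium at δ = 0, the conjunct's datum at δ = 1), if each used member δ_N is pinned
conjunct-style to its data (LLN at t = 0) and the
fields match (ρ, ρu, E)^(δ_N)(0) with AMPLITUDE-RELATIVE precision ηδ_N, then they match (ρ, ρu,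
E)^(δ_N)(t_N) with precision ηδ_N at
EVERY N-dependent time t_N < T(δ_N) with t_N·δ_N ≤ τ — the hydrodynamic limit uniformly along the
WEAKLY NONLINEAR DIAGONAL (amplitude
δ, times ≲ 1/δ), pre-shock. Corner δ_N ≡ 1, t_N ≡ t: literally the conjunct (`closes`, ten lines).
Floor δ_N = (N+1)^(−γ), t_N = s/δ_N:
the Kn ≪ δ_N sound windows, whose planar simple-wave members are inviscid BURGERS for the right
Riemann invariant (PreShockBurgersRung);
the card's post-shock theorem BurgersWindowLimit (Kruzhkov–Oleinik solution THROUGH the shock) rides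
on the same four cruxes
(WindowAssembly) but is not under the roof (no classical reference past T*). The time cap τ/δ_N is
essential: entropy-mode data are
stationary Euler solutions (T = ∞) and diffuse at t ≍ Kn⁻¹ = N^(1/3) ≫ τN^γ.
Lean: `open Literature.MathematicalPhysics.KineticTheory Literature.Analysis.FluidPDE MeasureTheory
Filter Topology in ∀ (a₀ θ₀ : T3 → ℝ) (u₀ : T3 → V3), Continuous a₀ → Continuous θ₀ → Continuous u₀
→ (∀ x, 0 < a₀ x) → (∀ x, 0 < θ₀ x) → ∀ θe : ℝ, 0 < θe → ∀ γ : ℝ, 0 < γ → γ < 1 / 3 → ∃ σ₀ : ℝ, 0 <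
σ₀ ∧ ∀ σ : ℝ, 0 < σ → σ < σ₀ → ∀ τ : ℝ, 0 < τ → ∀ (T : ℝ → ℝ) (ρE θE : ℝ → ℝ → T3 → ℝ) (uE : ℝ → ℝ →
T3 → V3), (∀ d ∈ Set.Ioc (0 : ℝ) 1, IsHardSphereEulerSolution σ (T d) (ρE d) (uE d) (θE d)) → ∀ Φ :
(N : ℕ) → HardSphereFlow (Torus.geometry (Fin 3)) (hsDiameter σ N) (N + 1), ∀ δ : ℕ → ℝ, (∀ N : ℕ,
((N : ℝ) + 1) ^ (-γ) ≤ δ N ∧ δ N ≤ 1) → (∀ N : ℕ, TendstoHydroFieldsAt (fun M => localGibbsLaw σ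
(fun x => a₀ x ^ δ N) (fun x => δ N • u₀ x) (fun x => θe ^ (1 - δ N) * θ₀ x ^ δ N) M (Φ M)) Φ (ρE (δ
N)) (uE (δ N)) (θE (δ N)) 0) → let P : (N : ℕ) → Measure (Config (N + 1) (Fin 3) T3) := fun N =>
localGibbsLaw σ (fun x => a₀ x ^ δ N) (fun x => δ N • u₀ x) (fun x => θe ^ (1 - δ N) * θ₀ x ^ δ N) N
(Φ N); let R : (ℕ → ℝ) → Prop := fun t => ∀ χ : T3 → ℝ, Continuous χ → ∀ η : ℝ, 0 < η → Tendsto (fun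
N => P N {z | η * δ N < |empiricalDensityField ((Φ N).flow (t N) z) χ - ∫ x, χ x * ρE (δ N) (t N)
x|}) atTop (𝓝 0) ∧ Tendsto (fun N => P N {z | η * δ N < ‖empiricalMomentumField ((Φ N).flow (t N) z)
χ - ∫ x, (χ x * ρE (δ N) (t N) x) • uE (δ N) (t N) x‖}) atTop (𝓝 0) ∧ Tendsto (fun N => P N {z | η *
δ N < |empiricalEnergyField ((Φ N).flow (t N) z) χ - ∫ x, χ x * totalEnergyDensity (ρE (δ N) (t N)
x) (uE (δ N) (t N) x) (θE (δ N) (t N) x)|}) atTop (𝓝 0); R (fun _ => 0) → ∀ t : ℕ → ℝ, (∀ N : ℕ, 0 ≤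
t N ∧ t N < T (δ N) ∧ t N * δ N ≤ τ) → R t`

## Assembly
DECIDING THEOREM (D-0027 §2.1; glue.lean = the `closes` of Sketch.lean, lean check rc 0, axioms
propext / Classical.choice /
Quot.sound): `theorem closes : ZoomUniformLimit → _root_.HydrodynamicLimit` — given profiles take θe
:= 1, γ := 1/4 and σ₀ from the top;
for σ < σ₀, a classical solution (ρ, u, θ) on [0,T), flows Φ, LLN datum h0 and t ∈ [0,T):
instantiate with horizon τ := t + 1, the
CONSTANT family d ↦ (T; ρ, u, θ), the constant amplitude δ_N ≡ 1 (floor: (N+1)^(−1/4) ≤ 1,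
Real.rpow_le_one_of_one_le_of_nonpos) and
constant times t_N ≡ t (0 ≤ t < T, t·1 ≤ t + 1); `simp only [Real.rpow_one, one_smul, sub_self,
Real.rpow_zero, one_mul, mul_one]`
turns the power path into localGibbsLaw σ a₀ u₀ θ₀ and ηδ_N into η, the pin and the
relative-precision datum are both h0, and the
conclusion is TendstoHydroFieldsAt at t. The other items hang off the top as its floor
(PreShockAssembly ⇒ PreShockBurgersRung) and as
the post-shock companion (WindowAssembly ⇒ BurgersWindowLimit); they are the route's working face,
the top is its roof.

Rationale: WHY THIS LINE. THE EULER ZOOM (the dictionary that makes the window the conjunct seen close up, not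
a detour): restrict the conjunct's unit-amplitude
smooth profile to a box of side ℓ and rescale hyperbolically — the box holds N_box = ℓ³N spheres of
the SAME reduced diameter
σ N_box^(−1/3) (box units), sees a perturbation of a constant state of amplitude ℓ, and the
conjunct's unit macroscopic time is 1/ℓ box
times: (amplitude δ, time 1/δ) with δ = ℓ is exactly the weakly nonlinear diagonal, and the window
condition δ ≫ Kn_box reads
ℓ ≫ Kn^(1/2) = N^(−1/6) (the acoustic damping length over unit time). So Euler closure for the
conjunct IS NS-sharp closure o(δ²) of a
near-constant state over the Burgers horizon in every mesoscopic box ℓ ∈ (N^(−1/6), 1), the boxes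
exchanging sound; the ladder parameter
δ_N is the box-to-torus ratio and the top's uniformity is the claim "closure is local and
amplitude-blind along the diagonal". Mechanism
at the floor (card): weakly nonlinear geometric acoustics applied to the EXACT particle conservation
laws (DipernaMajda1985, Majda1984,
Schochet1994: right Riemann invariant ⇒ ∂_s w + βw∂_ξ w = 0, β the fundamental derivative of p =
ρθZ(ρσ³)), closed pre-shock by relative
entropy for measure-valued Burgers with one convex entropy (Dafermos1979,
BrenierDeLellisSzekelyhidi2011) and post-shock by compensated
compactness + single-entropy Kruzhkov selection (Panov1994, DelellisOttoWestdickenberg2004,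
Dafermos2005 Ch. XVI); from probability only
the entropy inequality against the INVARIANT Gibbs law (KipnisLandim1999 Ch. 6; budget δ²N, tails
free for δ_N ≪ N^(−1/6)). Imported
areas: nonlinear acoustics and scalar conservation-law theory; nothing stochastic (TothValko2002,
FritzToth2004, Fritz2004 are the
1-D noisy precedents). Versus the board: CramerEdgeLadder climbs the same power-path family in
amplitude at FIXED macroscopic time
(linear sound rungs, cumulant cruxes); this ladder extends it along TIME to the nonlinear horizon
τ/δ (its top implies Cramér's) and
its cruxes are the two transport statements that only this horizon demands — FluxClosureL2
(longitudinal stress closes at o(δ²),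
bulk + 4/3 shear + conductivity channel, with no coefficient named) and EntropyProductionSign (LOCAL
second law at order δ³, the first
typed microscopic irreversibility statement of the sub) — the near-equilibrium, NS-precision special
cases of BoxDissipativeWeakStrong's
FluxClosure / EntropyAdmissibility, which by the zoom are the same local estimate at unit zoom.
Negatives index (3 in the sub: 9168
Enskog adjoint test family, 9236/9238 warm–cold cells) not touched.

RANKED CRUXES. #0 ZoomUniformLimit (target) — LADDER TOP as in § Thesis — amplitude-relative
hydrodynamic limit, uniform over amplitudes (N+1)^(−γ) ≤ δ_N ≤ 1 and N-dependent times t_N < T(δ_N),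
t_N δ_N ≤ τ, for the pinned power-path local Gibbs family; corner δ ≡ 1 = HydrodynamicLimit, floor =
the pre-shock sound/Burgers windows. (why it might fail: contains the conjunct; beyond it, relative
precision ηδ_N over τ/δ_N sound laps needs o(δ²) flux closure and phase coherence (c_N − c)/δ_N → 0
— an O(δ²) non-relaxing stress of deterministic spheres near equilibrium refutes the floor with the
conjunct intact.) [Spohn1991, OllaVaradhanYau1993, DipernaMajda1985, TothValko2002]
#2 FluxClosureL2 (crux) — (card W∥ + acoustic reduction; old stmt-5862 with the refuter's mean-zero
repair ∫r₀ = 0) planar right-going simple-wave power-path data of amplitude δ_N = (N+1)^(−γ), γ ∈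
(1/6,1/3), zero-mean profile r₀; slab block field V_N of width ℓ_N = (N+1)^(−(1/3−γ)/2) in the frame
moving at c, slow-time average U_N, flux G_N DEFINED from momentum increments (∂_sU_N + ∂_ξG_N = 0
identically, collisional transfer included), defect Θ_N = G_N − βU_N²/2 − mean: ‖Θ_N‖_(L²((0,S)×𝕋))
→ 0 in probability for every S. [difficulty: XL] (why it might fail: needs NS-order relaxation of
the longitudinal stress of DETERMINISTIC spheres near equilibrium, in L² at precision o(δ_N²) over
N^(1/3+γ) free times; nothing such is proved (MacroErgodicity, BoltzmannHypothesis); also uses c_N −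
c = O(Kn) ≪ δ_N.) [Spohn1991, FritzToth2004, KipnisLandim1999, DipernaMajda1985]
#3 EntropyProductionSign (crux) — (local second law at order δ³; old stmt-5863 + mean-zero) same
objects, D_N = Θ_N ∂_ξU_N: (i) ‖D_N‖_(L¹((0,S)×𝕋)) tight (shock dissipation is a bounded measure,
not → 0); (ii) the single convex entropy inequality for (U²/2, βU³/3) in 𝒟′ from s = 0 up to o_P(1):
wave energy decreases LOCALLY — the non-equilibrium stress opposes compression blockwise without
naming ν_eff. [deps: FluxClosureL2] [difficulty: XL] (why it might fail: the free second law
(Liouville + static LD vs the invariant law) is GLOBAL; the blockwise sign of Θ·∂U and in-place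
booking of shock heat are local-equilibrium inputs FritzToth2004 buy with noise; one mis-signed
mesoscopic ramp (rarefaction shock) breaks (ii).) [FritzToth2004, Fritz2004, Panov1994,
DelellisOttoWestdickenberg2004, KipnisLandim1999]
#4 BlockSupBound (crux) — (old stmt-5864 + mean-zero) sup over (s,ξ) ∈ [0,S]×𝕋 of |U_N(s,ξ)| is
tight: no mesoscopic slab ever carries mean velocity ≫ δ_N — the L^∞ frame for compensated
compactness and for the relative-entropy pre-shock step. [difficulty: L] (why it might fail: not
implied by the entropy budget: one rogue slab of Nℓ_N particles at velocity Mδ_N costs Nℓ_N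
M²δ_N²/2θ ≪ δ_N²N; needs a dynamical maximum-principle substitute (L¹-contraction lives only in the
limit equation).) [KipnisLandim1999, FritzToth2004, Dafermos2005]
#5 NoFastMode (crux) — (old stmt-5865 + mean-zero; the 2×2 non-resonance claim) for every fixed slow
time s ≥ 0, ‖V_N(s,·) − U_N(s,·)‖_(L²(𝕋)) → 0 in probability: no counter-propagating or other fast
component of rescaled amplitude O(1) survives c/δ_N torus laps, before or after shocks; passes from
the smoothed field to the fixed-time observable and identifies the initial trace. [difficulty: L]
(why it might fail: two sound families alone do not resonate (Majda–Rosales need the entropy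
family), but shocks emit entropy/reflected waves at O(δ³) per passage and each gas element is passed
c/δ_N times: accumulated effects are borderline, and must be proved for particles.) [Schochet1994,
DipernaMajda1985, Majda1984]
#9 BurgersWindowLimit (support) — THE CARD'S POST-SHOCK THEOREM (old target stmt-5861, mean-zero
repaired): same data; IF the rescaled initial fields converge to the right acoustic eigen-profile
(r₀/c, r₀e₁, θ̄(3/2+Z)r₀/c), THEN for every Oleinik solution w of ∂_s w + ∂_ξ(βw²/2) = 0 with datum
r₀ and EVERY s > 0 — through and after shock formation — the rescaled momentum field at macroscopic
time s/δ_N in the frame x₁ − cs/δ_N converges in probability to ∫φ w(s,·). Not under the ladder roof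
(no classical reference past T*); derived from cruxes 2–5 by WindowAssembly. [difficulty:
open-problem] [DipernaMajda1985, FritzToth2004, TothValko2002, Panov1994]
#9 BurgersOleinikWellPosed (support) — (known: Hopf–Lax / Oleinik; now Literature facts
`Literature.Analysis.PDE.hormander_hopfSolution_exists`, `oleinik_hopfSolution_unique` in
BurgersEntropySolutions.lean after u := βw and periodic lift) existence of a bounded measurable,
weakly continuous Oleinik (E-condition) weak solution with continuous periodic datum r₀, and
uniqueness of its φ-integrals. [difficulty: provable-now] [Hopf1951, Dafermos2005]
#9 SingleEntropySelectsOleinik (support) — (known: Panov / De Lellis–Otto–Westdickenberg; Literature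
fact `deLellisOttoWestdickenberg_singleEntropy`) a bounded weak solution of ∂_s u + ∂_ξ(βu²/2) = 0
with datum r₀ obeying the SINGLE entropy inequality for (u²/2, βu³/3) from s = 0 coincides a.e. with
an Oleinik solution. [difficulty: provable-now] [Panov1994, DelellisOttoWestdickenberg2004,
Dafermos2005]
#9 WindowAssembly (support) — the post-shock glue (old assembly stmt-5868): FluxClosureL2 →
EntropyProductionSign → BlockSupBound → NoFastMode → BurgersOleinikWellPosed →
SingleEntropySelectsOleinik → BurgersWindowLimit (entropy-inequality transfer of static Gaussian LD
for linear statistics, tightness in L^∞ weak-*, Skorokhod, Murat's lemma + div–curl with η = U²/2 ⇒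
Dirac Young measure (Tartar; Literature fact `tartar_youngMeasure_dirac`), single-entropy selection,
uniqueness ⇒ whole-sequence convergence in probability). [difficulty: L] [Dafermos2005,
KipnisLandim1999, Panov1994, FritzToth2004]
#9 PreShockBurgersRung (support) — FLOOR OF THE LADDER in the card's class: same data and
eigen-profile INIT; for every S > 0 and every CLASSICAL C¹ solution w of ∂_s w + βw∂_ξ w = 0 on
[0,S]×𝕋 with w(0) = r₀ (exists iff S is before the Burgers shock time), the rescaled momentum field
at time s/δ_N in the moving frame converges in probability to ∫φ w(s,·) for s ∈ (0,S]. Equals the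
bottom member of ZoomUniformLimit on planar simple-wave data up to the PDE reduction Euler(amplitude
δ) = δ·(w∘frame)·eigenvector + o(δ) for s ≤ S (DipernaMajda1985 for classical solutions), § Not
decomposed yet. [difficulty: open-problem] [DipernaMajda1985, Majda1984, TothValko2002]
#9 PreShockAssembly (support) — the pre-shock glue FluxClosureL2 → EntropyProductionSign →
BlockSupBound → NoFastMode → PreShockBurgersRung: limit Young measures are measure-valued solutions
of Burgers with the single convex entropy inequality from s = 0 (crux 3 (ii)); relative entropy ∫⟨ν,
(λ − w)²/2⟩ against the classical solution is Gronwall-controlled by ‖∂_ξ w‖_∞ (Dafermos1979 /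
BrenierDeLellisSzekelyhidi2011 for one convex entropy) ⇒ ν = δ_w pre-shock ⇒ convergence in
probability; no compensated compactness, no Oleinik selection needed here. [difficulty: M]
[Dafermos1979, BrenierDeLellisSzekelyhidi2011, Dafermos2005]

TWO-LAYER PLAN. Foreseen glued splits once a crux closes (k ≤ 3, depth 1; nothing filed now):
FluxClosureL2 ⇐ LongitudinalStressRelaxation (space-time L²
bound on the non-equilibrium longitudinal stress near equilibrium with a rate N^(−γ₀), γ₀ > γ — the
purely microscopic W∥) →
AcousticReductionAlgebra (Euler-level Taylor expansion in the momentum variable, equivalence of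
ensembles at order δ² on slabs, sound-speed
renormalisation c_N − c = O(Kn)) → FluxClosureL2. EntropyProductionSign ⇐ GlobalSecondLawCubicOrder
(free: G-invariance + static LD,
needs Nδ³ → ∞) → LocalEntropyBookkeeping (heat mode stays in place at block scale) →
EntropyProductionSign. ZoomUniformLimit ⇐ (rung by
rung, after the floor) BoxFluxClosure (FluxClosureL2 localised to boxes ℓ ∈ (N^(−1/6), 1) exchanging
sound, uniform in the background
state) → BoxSecondLaw → RelativeEnergyAlongTheDiagonal (BrezinaFeireisl2018-type weak–strong
stability with amplitude-relative modulated
energy) → ZoomUniformLimit.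

KILL CRITERIA. Refutation of FluxClosureL2 by an N-independent L² stress defect (event-driven MD:
β_eff ≠ β(hs EOS), or N-wave decay ≠ 1/s) closes the
route (`close --reason refuted:FluxClosureL2`) and is evidence against every Euler-closure route in
the longitudinal channel at every
zoom (BoxDissipativeWeakStrong K1, StrongClosureWeakBV). Refutation of ZoomUniformLimit at an
INTERMEDIATE rung with the floor intact
(amplitude-dependent loss of relative precision, a slow mode between δ and δ²) ⇒ restate the top
with the located precision law (the
ladder survives as a milestone chain; the conjunct corner is untouched) — restate, not close.
Refutation of EntropyProductionSign (ii)
with FluxClosureL2 intact ⇒ pivot: Oleinik one-sided block bound as crux (OleinikBlockBound) or an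
L^p Young-measure frame. Refutation of
BlockSupBound alone ⇒ L^p compensated compactness (p > 3). Refutation of NoFastMode ⇒ restate the
window items for time-averaged
observables. HydrodynamicLimit proved elsewhere closes the corner but NOT the floor or the
post-shock theorem (different limits); a
proof of BoxDissipativeWeakStrong's FluxClosure in L² form with a rate feeds crux 2 at unit zoom.

NOT DECOMPOSED YET. The PDE reduction identifying the floor of ZoomUniformLimit on planar
simple-wave data with PreShockBurgersRung (classical weakly
nonlinear acoustics with o(δ) error uniformly for s ≤ S < s*, DipernaMajda1985 / John–Majda energy
estimates; classical hs-Euler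
lifespan ≥ c/δ on 𝕋³ is supplied by hypothesis, never claimed); the intermediate rungs (boxes
exchanging sound: BoxFluxClosure etc.,
§ Two-layer plan); the microscopic transport lemma behind FluxClosureL2 and the local entropy
bookkeeping behind EntropyProductionSign;
the measure-theoretic plumbing of WindowAssembly / PreShockAssembly (Skorokhod, Young measures on
𝕋×(0,S), Murat's lemma, div–curl —
partly vendored as named facts in Literature/Analysis/PDE/BurgersEntropySolutions.lean); the static
inputs (H(P_N|G_N) ≤ CNδ², Gaussian
LD for block means under G, probability-measure property of the laws for σ < σ₀, equivalence of
ensembles on slabs); non-vacuity of the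
INIT hypotheses (local Gibbs LLN at order δ with κa = (Z+σ³Z′)/c, κθ = ⅔Z/c by cluster expansion;
for the top: pin = localGibbs_lln member
by member, relative-precision datum = finite-size corrections O(1/N) + fluctuations N^(−1/2) ≪
ηδ_N). All layer-2 children or
`--supports` lemmas (D-0019).

CHEAPEST FALSIFIER. (i) Analytic, free, done on paper: the ideal gas (collisionless kernel of
BoltzmannHypothesisBarrier) must FAIL FluxClosureL2 and the
floor of ZoomUniformLimit — it does (free streaming: the stress never relaxes to p(ρ,θ), Θ_N =
O(1/δ); phase mixing destroys the wave in
time O(1) ≪ 1/δ); hard rods fail too (extra invariants). (ii) Vacuity, done: the refuter's mean-zero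
slice (BW_MeanZero.lean on
stmt-5861: INIT at φ ≡ 1 forces ∫r₀ = 0) is repaired by the explicit hypothesis ∫r₀ = 0 in all five
window items; the top's corner is
the conjunct verbatim (closes rc 0) and its time cap excludes the diffusive counterexample
(stationary entropy-mode data at t ≍ N^(1/3)).
(iii) Cheap numerics a refuter can run first: event-driven MD of a planar zero-mean sinusoidal
simple wave, N = 10⁵–10⁷ in a
slab-periodic box, packing fraction 0.05–0.2, δ = 2–5·Kn^(1/2): shock-formation time, shock speed (β
= 4/3 + O(σ³)) and post-shock
N-wave decay w ∼ 1/s must match Kruzhkov–Burgers; an N-independent deviation kills FluxClosureL2 or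
NoFastMode; the same run at three
amplitudes δ, 2δ, 4δ tests the top's amplitude-uniformity of the relative error directly.

NUMBERS. Kn ≍ N^(−1/3)/σ² ((N+1)^(1/3) collisions per particle per unit macroscopic time). Zoom
dictionary: box ℓ ↔ amplitude δ = ℓ, N_box = ℓ³N,
box time unit = ℓ, unit macro time = 1/δ box times; window condition ℓ ≫ Kn^(1/2) = N^(−1/6) =
acoustic damping length √(Kn·1). Ladder:
floor exponent γ < 1/3 (δ_N ≫ Kn: shock width Kn/δ_N → 0, viscous/thermal corrections over τ/δ_N of
relative size Kn/δ_N = N^(γ−1/3) → 0,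
Burnett-order dispersion phase error Kn²τ/δ_N → 0, diffusive time N^(1/3) ≫ τN^γ); free-tail
sub-window γ ∈ (1/6, 1/3) for the window
items (entropy budget δ²N ≪ N^(2/3) = speed of cubic-moment one-big-jump deviations); Nδ_N³ =
N^(1−3γ) → ∞ (second law resolves the
cubic shock entropy); block exponent (1/3−γ)/2: Kn/δ_N ≪ ℓ_N ≪ 1 and slab thermal noise
√(θ/(Nℓ_Nδ_N²)) → 0; ideal-gas checks c² = 5θ/3,
β = 4/3 (= (γ_ad+1)/2); general c² = θ̄(Z + ⅔Z² + σ³Z′), β = 1 + Z/3 + σ³(2Z′ + 4/3·ZZ′ + σ³Z″)/(2(Z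
+ ⅔Z² + σ³Z′)); along a right simple
wave (Π − p̄ − cm)/δ² = (β/2)m²/ρ̄ + O(δ); energy eigen-component θ̄(3/2 + Z)/c; κa = (Z + σ³Z′)/c,
κθ = ⅔Z/c. Relative precision at the
floor: thermal fluctuations N^(−1/2) ≪ ηδ_N ⇔ γ < 1/2 ✓; finite-size EOS corrections O(1/N) ≪ ηδ_N
✓. Items at open: 12 (1 target, 4
cruxes, 6 supports, 1 assembly).

DEFINITION REQUESTS. None needed to type the items (all over HardSphereEuler.lean vocabulary +
inline Oleinik clauses). Optional later: a named
`BurgersEntropySolution` predicate on the circle wrapping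
Literature.Analysis.PDE.IsBurgersWeakSolution / BurgersConditionE (periodic
lift, u := βw) so that BurgersWindowLimit / BurgersOleinikWellPosed / SingleEntropySelectsOleinik
can be restated over it by a refuter's
`set-signature`; cite facts already vendored (hormander_hopfSolution_exists,
oleinik_hopfSolution_unique,
deLellisOttoWestdickenberg_singleEntropy, tartar_youngMeasure_dirac).

Novelty: Searches (2026-08-15): `lit search --hybrid "weakly nonlinear acoustics Burgers equation
hydrodynamic limit particle system uniform in
amplitude"` (12 textbook hits: Falkovich 2018 pp. 93–95, Woyczyński 1998, De Masi–Presutti 1991 pp.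
9–11, Liu 2000 — PDE/stochastic
level only); `lit galaxy search "hydrodynamic limit beyond the hyperbolic time scale" --star all`
(0), `"weakly nonlinear geometric
acoustics" --star all` (0), `"nonlinear geometric optics" --star panama` (5: Sharma, Quasilinear
Hyperbolic Systems — PDE level);
`lit search --source s2 "hydrodynamic limit inviscid Burgers deterministic dynamics hard spheres
weakly nonlinear"` (8: Spohn1991, Labbé
KPZ bridges — nothing deterministic); `lit search --source crossref "Toth Valko perturbation of
singular equilibria hyperbolic scaling
between CLT and Euler"` (found doi:10.1007/s00220-005-1314-9); OpenAlex 429 (budget exhausted),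
zbMATH 0; `lit frontier
AtomisticToContinuum --since 2021` (30 rows: arXiv:2310.13338 heat equation from a deterministic
dynamics is the only deterministic
hydrodynamic result, diffusive channel; doi:10.1007/s10955-026-03570-w MDP for a binary collision
model); `lit bridges --cross any`
(convex-integration surveys only); the retired route's and the card audit's searches re-read; ledger
negatives (3 in sub, unrelated).
Nearest prior art found: TothValko2002 (doi:10.1023/a:1019987628197) and Tóth–Valkó 2005
(doi:10.1007/s00220-005-1314-9): intermediate
scaling between CLT and Euler ⇒ Burgers / univ  [refs: 10.1007/s00220-005-1314-9, 10.1007/s10955-026-03570-w, 10.1023/a:1019987628197, 10.1007/s00220-004-1103-x, 2310.13338, doi:10.1007/s00220-005-1314-9, doi:10.1007/s10955-026-03570-w, doi:10.1023/a, doi:10.1007/s00220-004-1103-x, Spohn1991, TothValko2002, FritzToth2004, DipernaMajda1985]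

Barriers (technique_class: weakly-nonlinear-acoustics scalar-entropy amplitude-ladder): - technique_class: weakly-nonlinear-acoustics scalar-entropy amplitude-ladder
- Literature.Barriers.AtomisticToContinuum.ShockFormationBarrier: the roof (ZoomUniformLimit) and
PreShockBurgersRung stay pre-shock by hypothesis (classical reference on [0,T(δ))), inside evasion
(i) of the barrier's own list; the companion BurgersWindowLimit CROSSES it on purpose with no
reference solution (single-entropy Kruzhkov selection + compensated compactness, the class its
evasions_known (ii) names, here without noise — the bet is cruxes 2–3 replace the noise).
- Literature.Barriers.AtomisticToContinuum.ShockFormationBarrierNarrow: not met — no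
unshifted-Lipschitz-reference relative entropy is used past T*; before T* the reference is classical
and the barrier is void.
- Literature.Barriers.AtomisticToContinuum.WildSolutionsBarrier: void on the floor (scalar law:
admissible solutions unique; planar symmetry of the LAW removes multi-d wild solutions for
deterministic limits) and void under the roof (classical regime, weak–strong); never assumed away.
- Literature.Barriers.AtomisticToContinuum.HighMomentumCutoffBarrierNarrow: evaded on the window
items in the sub-window γ > 1/6 (entropy inequality only against the INVARIANT law, budget δ²N below
the N^(2/3) speed of cubic one-big-jump deviations; only linear velocity statistics transferred);
NOT evaded at the roof's upper rungs (δ ≍ 1: budget ≍ N) — there it is the shared open input of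
every conjunct route, conceded.
- Literature.Barriers.Ato

sub-problem: HydrodynamicLimit · status: open · opened planner-plancard-AtomisticToContinuum-Hydrody-1b159c31-g2-0 2026-08-15T19:01:08Z · rev 1 · ledger route-AtomisticToContinuum-BurgersZoomLadder
GENERATED by the gate from the ledger (D-0016/17). Provers cite these decls: `theorem foo : Summit.AtomisticToContinuum.HydrodynamicLimit.Theses.BurgersZoomLadder.<Decl> := …` in Summits/AtomisticToContinuum/HydrodynamicLimit/Theorems/<Name>.lean.
-/

namespace Summit.AtomisticToContinuum.HydrodynamicLimit.Theses.BurgersZoomLadder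

open scoped BigOperators Topology Manifold Classical MeasureTheory ProbabilityTheory Matrix InnerProductSpace ComplexConjugate ContinuousMap
open Filter Set Function TopologicalSpace MeasureTheory

attribute [summit_statement] _root_.HydrodynamicLimit

/-- item stmt-AtomisticToContinuum-13305 · target · rank 0 · open · by planner
why it might fail: contains the conjunct; beyond it, relative precision ηδ_N over τ/δ_N sound laps needs o(δ²) flux closure and phase coherence (c_N − c)/δ_N → 0 — an O(δ²) non-relaxing stress of deterministic spheres near equilibrium refutes the floor with the conjunct intact.
sources: Spohn1991, OllaVaradhanYau1993, DipernaMajda1985, TothValko2002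
[target] LADDER TOP as in § Thesis — amplitude-relative hydrodynamic limit, uniform over amplitudes
(N+1)^(−γ) ≤ δ_N ≤ 1 and N-dependent times t_N < T(δ_N), t_N δ_N ≤ τ, for the pinned power-path
local Gibbs family; corner δ ≡ 1 = HydrodynamicLimit, floor = the pre-shock sound/Burgers windows. -/
@[route_item "route-AtomisticToContinuum-BurgersZoomLadder"]
def ZoomUniformLimit : Prop :=
  open Literature.MathematicalPhysics.KineticTheory Literature.Analysis.FluidPDE MeasureTheory Filter Topology in ∀ (a₀ θ₀ : T3 → ℝ) (u₀ : T3 → V3), Continuous a₀ → Continuous θ₀ → Continuous u₀ → (∀ x, 0 < a₀ x) → (∀ x, 0 < θ₀ x) → ∀ θe : ℝ, 0 < θe → ∀ γ : ℝ, 0 < γ → γ < 1 / 3 → ∃ σ₀ : ℝ, 0 < σ₀ ∧ ∀ σ : ℝ, 0 < σ → σ < σ₀ → ∀ τ : ℝ, 0 < τ → ∀ (T : ℝ → ℝ) (ρE θE : ℝ → ℝ → T3 → ℝ) (uE : ℝ → ℝ → T3 → V3), (∀ d ∈ Set.Ioc (0 : ℝ) 1, IsHardSphereEulerSolution σ (T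 d) (ρE d) (uE d) (θE d)) → ∀ Φ : (N : ℕ) → HardSphereFlow (Torus.geometry (Fin 3)) (hsDiameter σ N) (N + 1), ∀ δ : ℕ → ℝ, (∀ N : ℕ, ((N : ℝ) + 1) ^ (-γ) ≤ δ N ∧ δ N ≤ 1) → (∀ N : ℕ, TendstoHydroFieldsAt (fun M => localGibbsLaw σ (fun x => a₀ x ^ δ N) (fun x => δ N • u₀ x) (fun x => θe ^ (1 - δ N) * θ₀ x ^ δ N) M (Φ M)) Φ (ρE (δ N)) (uE (δ N)) (θE (δ N)) 0) → let P : (N : ℕ) → Measure (Config (N + 1) (Fin 3) T3) := fun N => localGibbsLaw σ (fun x => a₀ x ^ δ N) (fun x => δ N • u₀ x) (fun x => θe ^ (1 - δ N) * θ₀ x ^ δ N) N (Φ N); let R : (ℕ → ℝ) → Prop := fun t => ∀ χ : T3 → ℝ, Continuous χ → ∀ η : ℝ, 0 < η → Tendsto (fun N => P N {z | η * δ N < |empiricalDensityField ((Φ N).flow (t N) z) χ - ∫ x, χ x * ρE (δ N) (t N) x|}) atTop (𝓝 0) ∧ Tendsto (fun N => P N {z | η * δ N < ‖empiricalMomentumField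 ((Φ N).flow (t N) z) χ - ∫ x, (χ x * ρE (δ N) (t N) x) • uE (δ N) (t N) x‖}) atTop (𝓝 0) ∧ Tendsto (fun N => P N {z | η * δ N < |empiricalEnergyField ((Φ N).flow (t N) z) χ - ∫ x, χ x * totalEnergyDensity (ρE (δ N) (t N) x) (uE (δ N) (t N) x) (θE (δ N) (t N) x)|}) atTop (𝓝 0); R (fun _ => 0) → ∀ t : ℕ → ℝ, (∀ N : ℕ, 0 ≤ t N ∧ t N < T (δ N) ∧ t N * δ N ≤ τ) → R t

/-- item stmt-AtomisticToContinuum-13306 · crux · rank 2 · open · by planner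
why it might fail: needs NS-order relaxation of the longitudinal stress of DETERMINISTIC spheres near equilibrium, in L² at precision o(δ_N²) over N^(1/3+γ) free times; nothing such is proved (MacroErgodicity, BoltzmannHypothesis); also uses c_N − c = O(Kn) ≪ δ_N.
sources: Spohn1991, FritzToth2004, KipnisLandim1999, DipernaMajda1985
[crux] (card W∥ + acoustic reduction; old stmt-5862 with the refuter's mean-zero repair ∫r₀ = 0)
planar right-going simple-wave power-path data of amplitude δ_N = (N+1)^(−γ), γ ∈ (1/6,1/3),
zero-mean profile r₀; slab block field V_N of width ℓ_N = (N+1)^(−(1/3−γ)/2) in the frame moving at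
c, slow-time average U_N, flux G_N DEFINED from momentum increments (∂_sU_N + ∂_ξG_N = 0
identically, collisional transfer included), defect Θ_N = G_N − βU_N²/2 − mean: ‖Θ_N‖_(L²((0,S)×𝕋))
→ 0 in probability for every S. [difficulty: XL] -/
@[route_item "route-AtomisticToContinuum-BurgersZoomLadder"]
def FluxClosureL2 : Prop :=
  ∀ θb : ℝ, 0 < θb → ∀ r₀ : UnitAddCircle → ℝ, Continuous r₀ → (∫ ξ, r₀ ξ) = 0 → ∀ γ : ℝ, 1 / 6 < γ → γ < 1 / 3 → ∃ σ₀ : ℝ, 0 < σ₀ ∧ ∀ σ : ℝ, 0 < σ → σ < σ₀ → ∀ Z Z₁ Z₂ : ℝ, Z = Literature.MathematicalPhysics.KineticTheory.hsCompressibility (σ ^ 3) → Z₁ = deriv Literature.MathematicalPhysics.KineticTheory.hsCompressibility (σ ^ 3) → Z₂ = deriv (deriv Literature.MathematicalPhysics.KineticTheory.hsCompressibility) (σ ^ 3) → ∀ c β : ℝ, 0 < c → c ^ 2 = θb * (Z + 2 / 3 * Z ^ 2 + σ ^ 3 * Z₁) → β = 1 + Z / 3 + σ ^ 3 * (2 *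 Z₁ + 4 / 3 * Z * Z₁ + σ ^ 3 * Z₂) / (2 * (Z + 2 / 3 * Z ^ 2 + σ ^ 3 * Z₁)) → ∀ ab κa κθ : ℝ, 0 < ab → ∀ Φ : (N : ℕ) → Literature.Analysis.FluidPDE.HardSphereFlow (Literature.Analysis.FluidPDE.Torus.geometry (Fin 3)) (Literature.MathematicalPhysics.KineticTheory.hsDiameter σ N) (N + 1), ∀ δ : ℕ → ℝ, (∀ N, δ N = ((N + 1 : ℕ) : ℝ) ^ (-γ)) → ∀ P : (N : ℕ) → MeasureTheory.Measure (Literature.Analysis.FluidPDE.Config (N + 1) (Fin 3) Literature.MathematicalPhysics.KineticTheory.T3), (∀ N, P N = Literature.MathematicalPhysics.KineticTheory.localGibbsLaw σ (fun x => ab * Real.exp (δ N * κa * r₀ (x 0))) (fun x => (δ N * r₀ (x 0)) • EuclideanSpace.single (0 : Fin 3) (1 : ℝ)) (fun x => θb * Real.exp (δ N * κθ * r₀ (x 0))) N (Φ N)) → (∀ φ : UnitAddCircle → ℝ, Continuous φ → ∀ ε : ℝ, 0 < ε → Filter.Tendsto (fun N => P N {z | ε < |(δ N)⁻¹ * (Literature.MathematicalPhysics.KineticTheory.empiricalDensityField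 z (fun x => φ (x 0)) - ∫ ξ, φ ξ) - c⁻¹ * ∫ ξ, φ ξ * r₀ ξ|}) Filter.atTop (nhds 0) ∧ Filter.Tendsto (fun N => P N {z | ε < |(δ N)⁻¹ * (Literature.MathematicalPhysics.KineticTheory.empiricalMomentumField z (fun x => φ (x 0))) 0 - ∫ ξ, φ ξ * r₀ ξ|}) Filter.atTop (nhds 0) ∧ Filter.Tendsto (fun N => P N {z | ε < |(δ N)⁻¹ * (Literature.MathematicalPhysics.KineticTheory.empiricalEnergyField z (fun x => φ (x 0)) - 3 / 2 * θb * ∫ ξ, φ ξ) - θb * (3 / 2 + Z) / c * ∫ ξ, φ ξ * r₀ ξ|}) Filter.atTop (nhds 0)) → ∀ ℓ : ℕ → ℝ, (∀ N, ℓ N = ((N + 1 : ℕ) : ℝ) ^ (-((1 / 3 - γ) / 2))) → ∀ V : (N : ℕ) → ℝ → UnitAddCircle → Literature.Analysis.FluidPDE.Config (N + 1) (Fin 3) Literature.MathematicalPhysics.KineticTheory.T3 → ℝ, (∀ N s ξ z, V N s ξ z = (δ N)⁻¹ * (Literature.MathematicalPhysics.KineticTheory.empiricalMomentumField ((Φ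 N).flow (s / δ N) z) (fun x => (1 + Real.cos (Real.pi * min 1 (‖x 0 - ((c * s / δ N : ℝ) : UnitAddCircle) - ξ‖ / ℓ N))) / (2 * ℓ N))) 0) → ∀ U : (N : ℕ) → ℝ → UnitAddCircle → Literature.Analysis.FluidPDE.Config (N + 1) (Fin 3) Literature.MathematicalPhysics.KineticTheory.T3 → ℝ, (∀ N s ξ z, U N s ξ z = ∫ s', (ℓ N)⁻¹ * Set.indicator (Set.Icc (0 : ℝ) 1) (fun r => 1 - Real.cos (2 * Real.pi * r)) ((s' - s) / ℓ N) * V N s' ξ z) → ∀ G : (N : ℕ) → ℝ → ℝ → Literature.Analysis.FluidPDE.Config (N + 1) (Fin 3) Literature.MathematicalPhysics.KineticTheory.T3 → ℝ, (∀ N s x z, G N s x z = ∫ s', ((ℓ N)⁻¹) ^ 2 * Set.indicator (Set.Icc (0 : ℝ) 1) (fun r => 2 * Real.pi * Real.sin (2 * Real.pi * r)) ((s' - s) / ℓ N) * ∫ y in (0 : ℝ)..x, V N s' (y : UnitAddCircle) z) → ∀ Θ : (N : ℕ) → ℝ → ℝ → Literature.Analysis.FluidPDE.Config (N + 1) (Fin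 3) Literature.MathematicalPhysics.KineticTheory.T3 → ℝ, (∀ N s x z, Θ N s x z = G N s x z - β / 2 * U N s (x : UnitAddCircle) z ^ 2 - ∫ y in (0 : ℝ)..1, (G N s y z - β / 2 * U N s (y : UnitAddCircle) z ^ 2)) → ∀ S : ℝ, 0 < S → ∀ ε : ℝ, 0 < ε → Filter.Tendsto (fun N => P N {z | ε < ∫ s in Set.Ioo 0 S, ∫ x in Set.Ioo (0 : ℝ) 1, Θ N s x z ^ 2}) Filter.atTop (nhds 0)

/-- item stmt-AtomisticToContinuum-13307 · crux · rank 3 · open · by planner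
why it might fail: the free second law (Liouville + static LD vs the invariant law) is GLOBAL; the blockwise sign of Θ·∂U and in-place booking of shock heat are local-equilibrium inputs FritzToth2004 buy with noise; one mis-signed mesoscopic ramp (rarefaction shock) breaks (ii).
sources: FritzToth2004, Fritz2004, Panov1994, DelellisOttoWestdickenberg2004, KipnisLandim1999
[crux] (local second law at order δ³; old stmt-5863 + mean-zero) same objects, D_N = Θ_N ∂_ξU_N: (i)
‖D_N‖_(L¹((0,S)×𝕋)) tight (shock dissipation is a bounded measure, not → 0); (ii) the single convex
entropy inequality for (U²/2, βU³/3) in 𝒟′ from s = 0 up to o_P(1): wave energy decreases LOCALLY —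
the non-equilibrium stress opposes compression blockwise without naming ν_eff. [deps: FluxClosureL2]
[difficulty: XL] -/
@[route_item "route-AtomisticToContinuum-BurgersZoomLadder"]
def EntropyProductionSign : Prop :=
  ∀ θb : ℝ, 0 < θb → ∀ r₀ : UnitAddCircle → ℝ, Continuous r₀ → (∫ ξ, r₀ ξ) = 0 → ∀ γ : ℝ, 1 / 6 < γ → γ < 1 / 3 → ∃ σ₀ : ℝ, 0 < σ₀ ∧ ∀ σ : ℝ, 0 < σ → σ < σ₀ → ∀ Z Z₁ Z₂ : ℝ, Z = Literature.MathematicalPhysics.KineticTheory.hsCompressibility (σ ^ 3) → Z₁ = deriv Literature.MathematicalPhysics.KineticTheory.hsCompressibility (σ ^ 3) → Z₂ = deriv (deriv Literature.MathematicalPhysics.KineticTheory.hsCompressibility) (σ ^ 3) → ∀ c β : ℝ, 0 < c → c ^ 2 = θb * (Z + 2 / 3 * Z ^ 2 + σ ^ 3 * Z₁) → β = 1 + Z / 3 + σ ^ 3 * (2 * Z₁ + 4 / 3 * Z * Z₁ + σ ^ 3 * Z₂) / (2 * (Z + 2 / 3 * Z ^ 2 + σ ^ 3 * Z₁)) → ∀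 ab κa κθ : ℝ, 0 < ab → ∀ Φ : (N : ℕ) → Literature.Analysis.FluidPDE.HardSphereFlow (Literature.Analysis.FluidPDE.Torus.geometry (Fin 3)) (Literature.MathematicalPhysics.KineticTheory.hsDiameter σ N) (N + 1), ∀ δ : ℕ → ℝ, (∀ N, δ N = ((N + 1 : ℕ) : ℝ) ^ (-γ)) → ∀ P : (N : ℕ) → MeasureTheory.Measure (Literature.Analysis.FluidPDE.Config (N + 1) (Fin 3) Literature.MathematicalPhysics.KineticTheory.T3), (∀ N, P N = Literature.MathematicalPhysics.KineticTheory.localGibbsLaw σ (fun x => ab * Real.exp (δ N * κa * r₀ (x 0))) (fun x => (δ N * r₀ (x 0)) • EuclideanSpace.single (0 : Fin 3) (1 : ℝ)) (fun x => θb * Real.exp (δ N * κθ * r₀ (x 0))) N (Φ N)) → (∀ φ : UnitAddCircle → ℝ, Continuous φ → ∀ ε : ℝ, 0 < ε → Filter.Tendsto (fun N => P N {z | ε < |(δ N)⁻¹ * (Literature.MathematicalPhysics.KineticTheory.empiricalDensityField z (fun x => φ (x 0)) - ∫ ξ, φ ξ) - c⁻¹ * ∫ ξ, φ ξ * r₀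 ξ|}) Filter.atTop (nhds 0) ∧ Filter.Tendsto (fun N => P N {z | ε < |(δ N)⁻¹ * (Literature.MathematicalPhysics.KineticTheory.empiricalMomentumField z (fun x => φ (x 0))) 0 - ∫ ξ, φ ξ * r₀ ξ|}) Filter.atTop (nhds 0) ∧ Filter.Tendsto (fun N => P N {z | ε < |(δ N)⁻¹ * (Literature.MathematicalPhysics.KineticTheory.empiricalEnergyField z (fun x => φ (x 0)) - 3 / 2 * θb * ∫ ξ, φ ξ) - θb * (3 / 2 + Z) / c * ∫ ξ, φ ξ * r₀ ξ|}) Filter.atTop (nhds 0)) → ∀ ℓ : ℕ → ℝ, (∀ N, ℓ N = ((N + 1 : ℕ) : ℝ) ^ (-((1 / 3 - γ) / 2))) → ∀ V : (N : ℕ) → ℝ → UnitAddCircle → Literature.Analysis.FluidPDE.Config (N + 1) (Fin 3) Literature.MathematicalPhysics.KineticTheory.T3 → ℝ, (∀ N s ξ z, V N s ξ z = (δ N)⁻¹ * (Literature.MathematicalPhysics.KineticTheory.empiricalMomentumField ((Φ N).flow (s / δ N) z) (fun x => (1 + Real.cos (Real.pi * min 1 (‖x 0 - ((c * s / δ N :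 ℝ) : UnitAddCircle) - ξ‖ / ℓ N))) / (2 * ℓ N))) 0) → ∀ U : (N : ℕ) → ℝ → UnitAddCircle → Literature.Analysis.FluidPDE.Config (N + 1) (Fin 3) Literature.MathematicalPhysics.KineticTheory.T3 → ℝ, (∀ N s ξ z, U N s ξ z = ∫ s', (ℓ N)⁻¹ * Set.indicator (Set.Icc (0 : ℝ) 1) (fun r => 1 - Real.cos (2 * Real.pi * r)) ((s' - s) / ℓ N) * V N s' ξ z) → ∀ G : (N : ℕ) → ℝ → ℝ → Literature.Analysis.FluidPDE.Config (N + 1) (Fin 3) Literature.MathematicalPhysics.KineticTheory.T3 → ℝ, (∀ N s x z, G N s x z = ∫ s', ((ℓ N)⁻¹) ^ 2 * Set.indicator (Set.Icc (0 : ℝ) 1) (fun r => 2 * Real.pi * Real.sin (2 * Real.pi * r)) ((s' - s) / ℓ N) * ∫ y in (0 : ℝ)..x, V N s' (y : UnitAddCircle) z) → ∀ Θ : (N : ℕ) → ℝ → ℝ → Literature.Analysis.FluidPDE.Config (N + 1) (Fin 3) Literature.MathematicalPhysics.KineticTheory.T3 → ℝ, (∀ N s x z, Θ N s x z = G N s x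 z - β / 2 * U N s (x : UnitAddCircle) z ^ 2 - ∫ y in (0 : ℝ)..1, (G N s y z - β / 2 * U N s (y : UnitAddCircle) z ^ 2)) → ∀ S : ℝ, 0 < S → (∀ ε : ℝ, 0 < ε → ∃ M : ℝ, ∀ᶠ N in Filter.atTop, P N {z | M < ∫ s in Set.Ioo 0 S, ∫ x in Set.Ioo (0 : ℝ) 1, |Θ N s x z * deriv (fun y : ℝ => U N s (y : UnitAddCircle) z) x|} ≤ ENNReal.ofReal ε) ∧ (∀ ψ : ℝ × ℝ → ℝ, ContDiff ℝ 1 ψ → HasCompactSupport ψ → (∀ p, 0 ≤ ψ p) → (∀ p : ℝ × ℝ, S ≤ p.1 → ψ p = 0) → ∀ ε : ℝ, 0 < ε → Filter.Tendsto (fun N => P N {z | (∫ s in Set.Ioi (0 : ℝ), ∫ x : ℝ, (U N s (x : UnitAddCircle) z ^ 2 / 2 * deriv (fun s' => ψ (s', x)) s + β / 3 * U N s (x : UnitAddCircle) z ^ 3 * deriv (fun x' => ψ (s, x')) x)) + ∫ x : ℝ, r₀ (x : UnitAddCircle) ^ 2 / 2 * ψ (0, x) < -ε}) Filter.atTop (nhds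 0))

/-- item stmt-AtomisticToContinuum-13308 · crux · rank 4 · open · by planner
why it might fail: not implied by the entropy budget: one rogue slab of Nℓ_N particles at velocity Mδ_N costs Nℓ_N M²δ_N²/2θ ≪ δ_N²N; needs a dynamical maximum-principle substitute (L¹-contraction lives only in the limit equation).
sources: KipnisLandim1999, FritzToth2004, Dafermos2005
[crux] (old stmt-5864 + mean-zero) sup over (s,ξ) ∈ [0,S]×𝕋 of |U_N(s,ξ)| is tight: no mesoscopic
slab ever carries mean velocity ≫ δ_N — the L^∞ frame for compensated compactness and for the
relative-entropy pre-shock step. [difficulty: L] -/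
@[route_item "route-AtomisticToContinuum-BurgersZoomLadder"]
def BlockSupBound : Prop :=
  ∀ θb : ℝ, 0 < θb → ∀ r₀ : UnitAddCircle → ℝ, Continuous r₀ → (∫ ξ, r₀ ξ) = 0 → ∀ γ : ℝ, 1 / 6 < γ → γ < 1 / 3 → ∃ σ₀ : ℝ, 0 < σ₀ ∧ ∀ σ : ℝ, 0 < σ → σ < σ₀ → ∀ Z Z₁ Z₂ : ℝ, Z = Literature.MathematicalPhysics.KineticTheory.hsCompressibility (σ ^ 3) → Z₁ = deriv Literature.MathematicalPhysics.KineticTheory.hsCompressibility (σ ^ 3) → Z₂ = deriv (deriv Literature.MathematicalPhysics.KineticTheory.hsCompressibility) (σ ^ 3) → ∀ c β : ℝ, 0 < c → c ^ 2 = θb * (Z + 2 / 3 * Z ^ 2 + σ ^ 3 * Z₁) → β = 1 + Z / 3 + σ ^ 3 * (2 * Z₁ + 4 / 3 * Z * Z₁ + σ ^ 3 * Z₂) / (2 * (Z + 2 / 3 * Z ^ 2 + σ ^ 3 * Z₁)) → ∀ ab κa κθ : ℝ, 0 < ab → ∀ Φ : (N : ℕ) → Literature.Analysis.FluidPDE.HardSphereFlow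 (Literature.Analysis.FluidPDE.Torus.geometry (Fin 3)) (Literature.MathematicalPhysics.KineticTheory.hsDiameter σ N) (N + 1), ∀ δ : ℕ → ℝ, (∀ N, δ N = ((N + 1 : ℕ) : ℝ) ^ (-γ)) → ∀ P : (N : ℕ) → MeasureTheory.Measure (Literature.Analysis.FluidPDE.Config (N + 1) (Fin 3) Literature.MathematicalPhysics.KineticTheory.T3), (∀ N, P N = Literature.MathematicalPhysics.KineticTheory.localGibbsLaw σ (fun x => ab * Real.exp (δ N * κa * r₀ (x 0))) (fun x => (δ N * r₀ (x 0)) • EuclideanSpace.single (0 : Fin 3) (1 : ℝ)) (fun x => θb * Real.exp (δ N * κθ * r₀ (x 0))) N (Φ N)) → (∀ φ : UnitAddCircle → ℝ, Continuous φ → ∀ ε : ℝ, 0 < ε → Filter.Tendsto (fun N => P N {z | ε < |(δ N)⁻¹ * (Literature.MathematicalPhysics.KineticTheory.empiricalDensityField z (fun x => φ (x 0)) - ∫ ξ, φ ξ) - c⁻¹ * ∫ ξ, φ ξ * r₀ ξ|}) Filter.atTop (nhds 0) ∧ Filter.Tendsto (fun N => P N {z | ε < |(δ N)⁻¹ * (Literature.MathematicalPhysics.KineticTheory.empiricalMomentumField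 z (fun x => φ (x 0))) 0 - ∫ ξ, φ ξ * r₀ ξ|}) Filter.atTop (nhds 0) ∧ Filter.Tendsto (fun N => P N {z | ε < |(δ N)⁻¹ * (Literature.MathematicalPhysics.KineticTheory.empiricalEnergyField z (fun x => φ (x 0)) - 3 / 2 * θb * ∫ ξ, φ ξ) - θb * (3 / 2 + Z) / c * ∫ ξ, φ ξ * r₀ ξ|}) Filter.atTop (nhds 0)) → ∀ ℓ : ℕ → ℝ, (∀ N, ℓ N = ((N + 1 : ℕ) : ℝ) ^ (-((1 / 3 - γ) / 2))) → ∀ V : (N : ℕ) → ℝ → UnitAddCircle → Literature.Analysis.FluidPDE.Config (N + 1) (Fin 3) Literature.MathematicalPhysics.KineticTheory.T3 → ℝ, (∀ N s ξ z, V N s ξ z = (δ N)⁻¹ * (Literature.MathematicalPhysics.KineticTheory.empiricalMomentumField ((Φ N).flow (s / δ N) z) (fun x => (1 + Real.cos (Real.pi * min 1 (‖x 0 - ((c * s / δ N : ℝ) : UnitAddCircle) - ξ‖ / ℓ N))) / (2 * ℓ N))) 0) → ∀ U : (N : ℕ) → ℝ → UnitAddCircle → Literature.Analysis.FluidPDE.Config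 (N + 1) (Fin 3) Literature.MathematicalPhysics.KineticTheory.T3 → ℝ, (∀ N s ξ z, U N s ξ z = ∫ s', (ℓ N)⁻¹ * Set.indicator (Set.Icc (0 : ℝ) 1) (fun r => 1 - Real.cos (2 * Real.pi * r)) ((s' - s) / ℓ N) * V N s' ξ z) → ∀ S : ℝ, 0 < S → ∀ ε : ℝ, 0 < ε → ∃ M : ℝ, ∀ᶠ N in Filter.atTop, P N {z | ∃ s ∈ Set.Icc 0 S, ∃ ξ : UnitAddCircle, M < |U N s ξ z|} ≤ ENNReal.ofReal ε

/-- item stmt-AtomisticToContinuum-13309 · crux · rank 5 · open · by planner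
why it might fail: two sound families alone do not resonate (Majda–Rosales need the entropy family), but shocks emit entropy/reflected waves at O(δ³) per passage and each gas element is passed c/δ_N times: accumulated effects are borderline, and must be proved for particles.
sources: Schochet1994, DipernaMajda1985, Majda1984
[crux] (old stmt-5865 + mean-zero; the 2×2 non-resonance claim) for every fixed slow time s ≥ 0,
‖V_N(s,·) − U_N(s,·)‖_(L²(𝕋)) → 0 in probability: no counter-propagating or other fast component of
rescaled amplitude O(1) survives c/δ_N torus laps, before or after shocks; passes from the smoothed
field to the fixed-time observable and identifies the initial trace. [difficulty: L] -/
@[route_item "route-AtomisticToContinuum-BurgersZoomLadder"]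
def NoFastMode : Prop :=
  ∀ θb : ℝ, 0 < θb → ∀ r₀ : UnitAddCircle → ℝ, Continuous r₀ → (∫ ξ, r₀ ξ) = 0 → ∀ γ : ℝ, 1 / 6 < γ → γ < 1 / 3 → ∃ σ₀ : ℝ, 0 < σ₀ ∧ ∀ σ : ℝ, 0 < σ → σ < σ₀ → ∀ Z Z₁ Z₂ : ℝ, Z = Literature.MathematicalPhysics.KineticTheory.hsCompressibility (σ ^ 3) → Z₁ = deriv Literature.MathematicalPhysics.KineticTheory.hsCompressibility (σ ^ 3) → Z₂ = deriv (deriv Literature.MathematicalPhysics.KineticTheory.hsCompressibility) (σ ^ 3) → ∀ c β : ℝ, 0 < c → c ^ 2 = θb * (Z + 2 / 3 * Z ^ 2 + σ ^ 3 * Z₁) → β = 1 + Z / 3 + σ ^ 3 * (2 * Z₁ + 4 / 3 * Z * Z₁ + σ ^ 3 * Z₂) / (2 * (Z + 2 / 3 * Z ^ 2 + σ ^ 3 * Z₁)) → ∀ ab κa κθ : ℝ, 0 < ab → ∀ Φ : (N : ℕ) → Literature.Analysis.FluidPDE.HardSphereFlow (Literature.Analysis.FluidPDE.Torus.geometry (Fin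 3)) (Literature.MathematicalPhysics.KineticTheory.hsDiameter σ N) (N + 1), ∀ δ : ℕ → ℝ, (∀ N, δ N = ((N + 1 : ℕ) : ℝ) ^ (-γ)) → ∀ P : (N : ℕ) → MeasureTheory.Measure (Literature.Analysis.FluidPDE.Config (N + 1) (Fin 3) Literature.MathematicalPhysics.KineticTheory.T3), (∀ N, P N = Literature.MathematicalPhysics.KineticTheory.localGibbsLaw σ (fun x => ab * Real.exp (δ N * κa * r₀ (x 0))) (fun x => (δ N * r₀ (x 0)) • EuclideanSpace.single (0 : Fin 3) (1 : ℝ)) (fun x => θb * Real.exp (δ N * κθ * r₀ (x 0))) N (Φ N)) → (∀ φ : UnitAddCircle → ℝ, Continuous φ → ∀ ε : ℝ, 0 < ε → Filter.Tendsto (fun N => P N {z | ε < |(δ N)⁻¹ * (Literature.MathematicalPhysics.KineticTheory.empiricalDensityField z (fun x => φ (x 0)) - ∫ ξ, φ ξ) - c⁻¹ * ∫ ξ, φ ξ * r₀ ξ|}) Filter.atTop (nhds 0) ∧ Filter.Tendsto (fun N => P N {z | ε < |(δ N)⁻¹ * (Literature.MathematicalPhysics.KineticTheory.empiricalMomentumField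 z (fun x => φ (x 0))) 0 - ∫ ξ, φ ξ * r₀ ξ|}) Filter.atTop (nhds 0) ∧ Filter.Tendsto (fun N => P N {z | ε < |(δ N)⁻¹ * (Literature.MathematicalPhysics.KineticTheory.empiricalEnergyField z (fun x => φ (x 0)) - 3 / 2 * θb * ∫ ξ, φ ξ) - θb * (3 / 2 + Z) / c * ∫ ξ, φ ξ * r₀ ξ|}) Filter.atTop (nhds 0)) → ∀ ℓ : ℕ → ℝ, (∀ N, ℓ N = ((N + 1 : ℕ) : ℝ) ^ (-((1 / 3 - γ) / 2))) → ∀ V : (N : ℕ) → ℝ → UnitAddCircle → Literature.Analysis.FluidPDE.Config (N + 1) (Fin 3) Literature.MathematicalPhysics.KineticTheory.T3 → ℝ, (∀ N s ξ z, V N s ξ z = (δ N)⁻¹ * (Literature.MathematicalPhysics.KineticTheory.empiricalMomentumField ((Φ N).flow (s / δ N) z) (fun x => (1 + Real.cos (Real.pi * min 1 (‖x 0 - ((c * s / δ N : ℝ) : UnitAddCircle) - ξ‖ / ℓ N))) / (2 * ℓ N))) 0) → ∀ U : (N : ℕ) → ℝ → UnitAddCircle → Literature.Analysis.FluidPDE.Config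 (N + 1) (Fin 3) Literature.MathematicalPhysics.KineticTheory.T3 → ℝ, (∀ N s ξ z, U N s ξ z = ∫ s', (ℓ N)⁻¹ * Set.indicator (Set.Icc (0 : ℝ) 1) (fun r => 1 - Real.cos (2 * Real.pi * r)) ((s' - s) / ℓ N) * V N s' ξ z) → ∀ s : ℝ, 0 ≤ s → ∀ ε : ℝ, 0 < ε → Filter.Tendsto (fun N => P N {z | ε < ∫ ξ, (V N s ξ z - U N s ξ z) ^ 2}) Filter.atTop (nhds 0)

/-- item stmt-AtomisticToContinuum-13310 · support · rank 9 · open · by planner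
sources: DipernaMajda1985, FritzToth2004, TothValko2002, Panov1994
[support] THE CARD'S POST-SHOCK THEOREM (old target stmt-5861, mean-zero repaired): same data; IF
the rescaled initial fields converge to the right acoustic eigen-profile (r₀/c, r₀e₁,
θ̄(3/2+Z)r₀/c), THEN for every Oleinik solution w of ∂_s w + ∂_ξ(βw²/2) = 0 with datum r₀ and EVERY
s > 0 — through and after shock formation — the rescaled momentum field at macroscopic time s/δ_N in
the frame x₁ − cs/δ_N converges in probability to ∫φ w(s,·). Not under the ladder roof (no classical
reference past T*); derived from cruxes 2–5 by WindowAssembly. [difficulty: open-problem] -/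
@[route_item "route-AtomisticToContinuum-BurgersZoomLadder"]
def BurgersWindowLimit : Prop :=
  ∀ θb : ℝ, 0 < θb → ∀ r₀ : UnitAddCircle → ℝ, Continuous r₀ → (∫ ξ, r₀ ξ) = 0 → ∀ γ : ℝ, 1 / 6 < γ → γ < 1 / 3 → ∃ σ₀ : ℝ, 0 < σ₀ ∧ ∀ σ : ℝ, 0 < σ → σ < σ₀ → ∀ Z Z₁ Z₂ : ℝ, Z = Literature.MathematicalPhysics.KineticTheory.hsCompressibility (σ ^ 3) → Z₁ = deriv Literature.MathematicalPhysics.KineticTheory.hsCompressibility (σ ^ 3) → Z₂ = deriv (deriv Literature.MathematicalPhysics.KineticTheory.hsCompressibility) (σ ^ 3) → ∀ c β : ℝ, 0 < c → c ^ 2 = θb * (Z + 2 / 3 * Z ^ 2 + σ ^ 3 * Z₁) → β = 1 + Z / 3 + σ ^ 3 * (2 * Z₁ + 4 / 3 * Z * Z₁ + σ ^ 3 * Z₂) / (2 * (Z + 2 / 3 * Z ^ 2 + σ ^ 3 * Z₁)) → ∀ ab κa κθ : ℝ, 0 < ab → ∀ Φ : (N : ℕ) → Literature.Analysis.FluidPDE.HardSphereFlow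 (Literature.Analysis.FluidPDE.Torus.geometry (Fin 3)) (Literature.MathematicalPhysics.KineticTheory.hsDiameter σ N) (N + 1), ∀ δ : ℕ → ℝ, (∀ N, δ N = ((N + 1 : ℕ) : ℝ) ^ (-γ)) → ∀ P : (N : ℕ) → MeasureTheory.Measure (Literature.Analysis.FluidPDE.Config (N + 1) (Fin 3) Literature.MathematicalPhysics.KineticTheory.T3), (∀ N, P N = Literature.MathematicalPhysics.KineticTheory.localGibbsLaw σ (fun x => ab * Real.exp (δ N * κa * r₀ (x 0))) (fun x => (δ N * r₀ (x 0)) • EuclideanSpace.single (0 : Fin 3) (1 : ℝ)) (fun x => θb * Real.exp (δ N * κθ * r₀ (x 0))) N (Φ N)) → (∀ φ : UnitAddCircle → ℝ, Continuous φ → ∀ ε : ℝ, 0 < ε → Filter.Tendsto (fun N => P N {z | ε < |(δ N)⁻¹ * (Literature.MathematicalPhysics.KineticTheory.empiricalDensityField z (fun x => φ (x 0)) - ∫ ξ, φ ξ) - c⁻¹ * ∫ ξ, φ ξ * r₀ ξ|}) Filter.atTop (nhds 0) ∧ Filter.Tendsto (fun N => P N {z | ε < |(δ N)⁻¹ * (Literature.MathematicalPhysics.KineticTheory.empiricalMomentumField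 z (fun x => φ (x 0))) 0 - ∫ ξ, φ ξ * r₀ ξ|}) Filter.atTop (nhds 0) ∧ Filter.Tendsto (fun N => P N {z | ε < |(δ N)⁻¹ * (Literature.MathematicalPhysics.KineticTheory.empiricalEnergyField z (fun x => φ (x 0)) - 3 / 2 * θb * ∫ ξ, φ ξ) - θb * (3 / 2 + Z) / c * ∫ ξ, φ ξ * r₀ ξ|}) Filter.atTop (nhds 0)) → ∀ w : ℝ → UnitAddCircle → ℝ, (∃ M : ℝ, ∀ s ξ, |w s ξ| ≤ M) ∧ Measurable (Function.uncurry w) ∧ (∀ φ : UnitAddCircle → ℝ, Continuous φ → ContinuousOn (fun s => ∫ ξ, φ ξ * w s ξ) (Set.Ioi 0)) ∧ (∀ s : ℝ, 0 < s → ∀ ξ : UnitAddCircle, ∀ h : ℝ, 0 < h → w s (ξ + (h : UnitAddCircle)) - w s ξ ≤ h / (β * s)) ∧ (∀ ψ : ℝ × ℝ → ℝ, ContDiff ℝ 1 ψ → HasCompactSupport ψ → (∫ s in Set.Ioi (0 : ℝ), ∫ x : ℝ, (w s (x : UnitAddCircle) * deriv (fun s' => ψ (s', x)) s + β / 2 *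 w s (x : UnitAddCircle) ^ 2 * deriv (fun x' => ψ (s, x')) x)) + ∫ x : ℝ, r₀ (x : UnitAddCircle) * ψ (0, x) = 0) → ∀ s : ℝ, 0 < s → ∀ φ : UnitAddCircle → ℝ, Continuous φ → ∀ ε : ℝ, 0 < ε → Filter.Tendsto (fun N => P N {z | ε < |(δ N)⁻¹ * (Literature.MathematicalPhysics.KineticTheory.empiricalMomentumField ((Φ N).flow (s / δ N) z) (fun x => φ (x 0 - ((c * s / δ N : ℝ) : UnitAddCircle)))) 0 - ∫ ξ, φ ξ * w s ξ|}) Filter.atTop (nhds 0)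

/-- item stmt-AtomisticToContinuum-13311 · support · rank 9 · open · by planner
sources: Hopf1951, Dafermos2005
[support] (known: Hopf–Lax / Oleinik; now Literature facts
`Literature.Analysis.PDE.hormander_hopfSolution_exists`, `oleinik_hopfSolution_unique` in
BurgersEntropySolutions.lean after u := βw and periodic lift) existence of a bounded measurable,
weakly continuous Oleinik (E-condition) weak solution with continuous periodic datum r₀, and
uniqueness of its φ-integrals. [difficulty: provable-now] -/
@[route_item "route-AtomisticToContinuum-BurgersZoomLadder"]
def BurgersOleinikWellPosed : Prop :=
  ∀ β : ℝ, 0 < β → ∀ r₀ : UnitAddCircle → ℝ, Continuous r₀ → (∃ w : ℝ → UnitAddCircle → ℝ, (∃ M : ℝ, ∀ s ξ, |w s ξ| ≤ M) ∧ Measurable (Function.uncurry w) ∧ (∀ φ : UnitAddCircle → ℝ, Continuous φ → ContinuousOn (fun s => ∫ ξ, φ ξ * w s ξ) (Set.Ioi 0)) ∧ (∀ s : ℝ, 0 < s → ∀ ξ : UnitAddCircle, ∀ h : ℝ, 0 < h → w s (ξ + (h : UnitAddCircle)) - w s ξ ≤ h / (β * s)) ∧ (∀ ψ : ℝ × ℝ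 → ℝ, ContDiff ℝ 1 ψ → HasCompactSupport ψ → (∫ s in Set.Ioi (0 : ℝ), ∫ x : ℝ, (w s (x : UnitAddCircle) * deriv (fun s' => ψ (s', x)) s + β / 2 * w s (x : UnitAddCircle) ^ 2 * deriv (fun x' => ψ (s, x')) x)) + ∫ x : ℝ, r₀ (x : UnitAddCircle) * ψ (0, x) = 0)) ∧ (∀ w w' : ℝ → UnitAddCircle → ℝ, (∃ M : ℝ, ∀ s ξ, |w s ξ| ≤ M) ∧ Measurable (Function.uncurry w) ∧ (∀ φ : UnitAddCircle → ℝ, Continuous φ → ContinuousOn (fun s => ∫ ξ, φ ξ * w s ξ) (Set.Ioi 0)) ∧ (∀ s : ℝ, 0 < s → ∀ ξ : UnitAddCircle, ∀ h : ℝ, 0 < h → w s (ξ + (h : UnitAddCircle)) - w s ξ ≤ h / (β * s)) ∧ (∀ ψ : ℝ × ℝ → ℝ, ContDiff ℝ 1 ψ → HasCompactSupport ψ → (∫ s in Set.Ioi (0 : ℝ), ∫ x : ℝ, (w s (x : UnitAddCircle) * deriv (fun s' => ψ (s', x)) s + β / 2 * w s (x : UnitAddCircle) ^ 2 * deriv (fun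 x' => ψ (s, x')) x)) + ∫ x : ℝ, r₀ (x : UnitAddCircle) * ψ (0, x) = 0) → (∃ M : ℝ, ∀ s ξ, |w' s ξ| ≤ M) ∧ Measurable (Function.uncurry w') ∧ (∀ φ : UnitAddCircle → ℝ, Continuous φ → ContinuousOn (fun s => ∫ ξ, φ ξ * w' s ξ) (Set.Ioi 0)) ∧ (∀ s : ℝ, 0 < s → ∀ ξ : UnitAddCircle, ∀ h : ℝ, 0 < h → w' s (ξ + (h : UnitAddCircle)) - w' s ξ ≤ h / (β * s)) ∧ (∀ ψ : ℝ × ℝ → ℝ, ContDiff ℝ 1 ψ → HasCompactSupport ψ → (∫ s in Set.Ioi (0 : ℝ), ∫ x : ℝ, (w' s (x : UnitAddCircle) * deriv (fun s' => ψ (s', x)) s + β / 2 * w' s (x : UnitAddCircle) ^ 2 * deriv (fun x' => ψ (s, x')) x)) + ∫ x : ℝ, r₀ (x : UnitAddCircle) * ψ (0, x) = 0) → ∀ s : ℝ, 0 < s → ∀ φ : UnitAddCircle → ℝ, Continuous φ → ∫ ξ, φ ξ * w s ξ = ∫ ξ, φ ξ * w' s ξ)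

/-- item stmt-AtomisticToContinuum-13312 · support · rank 9 · open · by planner
sources: Panov1994, DelellisOttoWestdickenberg2004, Dafermos2005
[support] (known: Panov / De Lellis–Otto–Westdickenberg; Literature fact
`deLellisOttoWestdickenberg_singleEntropy`) a bounded weak solution of ∂_s u + ∂_ξ(βu²/2) = 0 with
datum r₀ obeying the SINGLE entropy inequality for (u²/2, βu³/3) from s = 0 coincides a.e. with an
Oleinik solution. [difficulty: provable-now] -/
@[route_item "route-AtomisticToContinuum-BurgersZoomLadder"]
def SingleEntropySelectsOleinik : Prop :=
  ∀ β : ℝ, 0 < β → ∀ r₀ : UnitAddCircle → ℝ, Continuous r₀ → ∀ u : ℝ → UnitAddCircle → ℝ, (∃ M : ℝ, ∀ s ξ, |u s ξ| ≤ M) → Measurable (Function.uncurry u) → (∀ ψ : ℝ × ℝ → ℝ, ContDiff ℝ 1 ψ → HasCompactSupport ψ → (∫ s in Set.Ioi (0 : ℝ), ∫ x : ℝ, (u s (x : UnitAddCircle) * deriv (fun s' => ψ (s', x)) s + β / 2 * u s (x : UnitAddCircle) ^ 2 * deriv (fun x' => ψ (s, x')) x)) + ∫ x : ℝ, r₀ (x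 : UnitAddCircle) * ψ (0, x) = 0) → (∀ ψ : ℝ × ℝ → ℝ, ContDiff ℝ 1 ψ → HasCompactSupport ψ → (∀ p, 0 ≤ ψ p) → 0 ≤ (∫ s in Set.Ioi (0 : ℝ), ∫ x : ℝ, (u s (x : UnitAddCircle) ^ 2 / 2 * deriv (fun s' => ψ (s', x)) s + β / 3 * u s (x : UnitAddCircle) ^ 3 * deriv (fun x' => ψ (s, x')) x)) + ∫ x : ℝ, r₀ (x : UnitAddCircle) ^ 2 / 2 * ψ (0, x)) → ∃ w : ℝ → UnitAddCircle → ℝ, (∃ M : ℝ, ∀ s ξ, |w s ξ| ≤ M) ∧ Measurable (Function.uncurry w) ∧ (∀ φ : UnitAddCircle → ℝ, Continuous φ → ContinuousOn (fun s => ∫ ξ, φ ξ * w s ξ) (Set.Ioi 0)) ∧ (∀ s : ℝ, 0 < s → ∀ ξ : UnitAddCircle, ∀ h : ℝ, 0 < h → w s (ξ + (h : UnitAddCircle)) - w s ξ ≤ h / (β * s)) ∧ (∀ ψ : ℝ × ℝ → ℝ, ContDiff ℝ 1 ψ → HasCompactSupport ψ → (∫ s in Set.Ioi (0 : ℝ),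 ∫ x : ℝ, (w s (x : UnitAddCircle) * deriv (fun s' => ψ (s', x)) s + β / 2 * w s (x : UnitAddCircle) ^ 2 * deriv (fun x' => ψ (s, x')) x)) + ∫ x : ℝ, r₀ (x : UnitAddCircle) * ψ (0, x) = 0) ∧ ∀ᵐ p : ℝ × UnitAddCircle, 0 < p.1 → u p.1 p.2 = w p.1 p.2

/-- item stmt-AtomisticToContinuum-13313 · support · rank 9 · open · by planner
sources: Dafermos2005, KipnisLandim1999, Panov1994, FritzToth2004
[support] the post-shock glue (old assembly stmt-5868): FluxClosureL2 → EntropyProductionSign →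
BlockSupBound → NoFastMode → BurgersOleinikWellPosed → SingleEntropySelectsOleinik →
BurgersWindowLimit (entropy-inequality transfer of static Gaussian LD for linear statistics,
tightness in L^∞ weak-*, Skorokhod, Murat's lemma + div–curl with η = U²/2 ⇒ Dirac Young measure
(Tartar; Literature fact `tartar_youngMeasure_dirac`), single-entropy selection, uniqueness ⇒
whole-sequence convergence in probability). [difficulty: L] -/
@[route_item "route-AtomisticToContinuum-BurgersZoomLadder"]
def WindowAssembly : Prop :=
  FluxClosureL2 → EntropyProductionSign → BlockSupBound → NoFastMode → BurgersOleinikWellPosed → SingleEntropySelectsOleinik → BurgersWindowLimit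

/-- item stmt-AtomisticToContinuum-13314 · support · rank 9 · open · by planner
sources: DipernaMajda1985, Majda1984, TothValko2002
[support] FLOOR OF THE LADDER in the card's class: same data and eigen-profile INIT; for every S > 0
and every CLASSICAL C¹ solution w of ∂_s w + βw∂_ξ w = 0 on [0,S]×𝕋 with w(0) = r₀ (exists iff S is
before the Burgers shock time), the rescaled momentum field at time s/δ_N in the moving frame
converges in probability to ∫φ w(s,·) for s ∈ (0,S]. Equals the bottom member of ZoomUniformLimit on
planar simple-wave data up to the PDE reduction Euler(amplitude δ) = δ·(w∘frame)·eigenvector + o(δ)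
for s ≤ S (DipernaMajda1985 for classical solutions), § Not decomposed yet. [difficulty:
open-problem] -/
@[route_item "route-AtomisticToContinuum-BurgersZoomLadder"]
def PreShockBurgersRung : Prop :=
  ∀ θb : ℝ, 0 < θb → ∀ r₀ : UnitAddCircle → ℝ, Continuous r₀ → (∫ ξ, r₀ ξ) = 0 → ∀ γ : ℝ, 1 / 6 < γ → γ < 1 / 3 → ∃ σ₀ : ℝ, 0 < σ₀ ∧ ∀ σ : ℝ, 0 < σ → σ < σ₀ → ∀ Z Z₁ Z₂ : ℝ, Z = Literature.MathematicalPhysics.KineticTheory.hsCompressibility (σ ^ 3) → Z₁ = deriv Literature.MathematicalPhysics.KineticTheory.hsCompressibility (σ ^ 3) → Z₂ = deriv (deriv Literature.MathematicalPhysics.KineticTheory.hsCompressibility) (σ ^ 3) → ∀ c β : ℝ, 0 < c → c ^ 2 = θb * (Z + 2 / 3 * Z ^ 2 + σ ^ 3 * Z₁) → β = 1 + Z / 3 + σ ^ 3 * (2 * Z₁ + 4 / 3 * Z * Z₁ + σ ^ 3 * Z₂) / (2 * (Z + 2 / 3 * Z ^ 2 + σ ^ 3 * Z₁)) → ∀ ab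 κa κθ : ℝ, 0 < ab → ∀ Φ : (N : ℕ) → Literature.Analysis.FluidPDE.HardSphereFlow (Literature.Analysis.FluidPDE.Torus.geometry (Fin 3)) (Literature.MathematicalPhysics.KineticTheory.hsDiameter σ N) (N + 1), ∀ δ : ℕ → ℝ, (∀ N, δ N = ((N + 1 : ℕ) : ℝ) ^ (-γ)) → ∀ P : (N : ℕ) → MeasureTheory.Measure (Literature.Analysis.FluidPDE.Config (N + 1) (Fin 3) Literature.MathematicalPhysics.KineticTheory.T3), (∀ N, P N = Literature.MathematicalPhysics.KineticTheory.localGibbsLaw σ (fun x => ab * Real.exp (δ N * κa * r₀ (x 0))) (fun x => (δ N * r₀ (x 0)) • EuclideanSpace.single (0 : Fin 3) (1 : ℝ)) (fun x => θb * Real.exp (δ N * κθ * r₀ (x 0))) N (Φ N)) → (∀ φ : UnitAddCircle → ℝ, Continuous φ → ∀ ε : ℝ, 0 < ε → Filter.Tendsto (fun N => P N {z | ε < |(δ N)⁻¹ * (Literature.MathematicalPhysics.KineticTheory.empiricalDensityField z (fun x => φ (x 0)) - ∫ ξ, φ ξ) - c⁻¹ * ∫ ξ, φ ξ * r₀ ξ|})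 Filter.atTop (nhds 0) ∧ Filter.Tendsto (fun N => P N {z | ε < |(δ N)⁻¹ * (Literature.MathematicalPhysics.KineticTheory.empiricalMomentumField z (fun x => φ (x 0))) 0 - ∫ ξ, φ ξ * r₀ ξ|}) Filter.atTop (nhds 0) ∧ Filter.Tendsto (fun N => P N {z | ε < |(δ N)⁻¹ * (Literature.MathematicalPhysics.KineticTheory.empiricalEnergyField z (fun x => φ (x 0)) - 3 / 2 * θb * ∫ ξ, φ ξ) - θb * (3 / 2 + Z) / c * ∫ ξ, φ ξ * r₀ ξ|}) Filter.atTop (nhds 0)) → ∀ S : ℝ, 0 < S → ∀ w : ℝ → UnitAddCircle → ℝ, ContDiff ℝ 1 (fun p : ℝ × ℝ => w p.1 (p.2 : UnitAddCircle)) → (∀ ξ : UnitAddCircle, w 0 ξ = r₀ ξ) → (∀ s ∈ Set.Icc (0 : ℝ) S, ∀ x : ℝ, deriv (fun s' => w s' (x : UnitAddCircle)) s + β * w s (x : UnitAddCircle) * deriv (fun x' : ℝ => w s (x' : UnitAddCircle)) x = 0) → ∀ s ∈ Set.Ioc (0 : ℝ) S, ∀ φ : UnitAddCircle → ℝ, Continuous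 φ → ∀ ε : ℝ, 0 < ε → Filter.Tendsto (fun N => P N {z | ε < |(δ N)⁻¹ * (Literature.MathematicalPhysics.KineticTheory.empiricalMomentumField ((Φ N).flow (s / δ N) z) (fun x => φ (x 0 - ((c * s / δ N : ℝ) : UnitAddCircle)))) 0 - ∫ ξ, φ ξ * w s ξ|}) Filter.atTop (nhds 0)

/-- item stmt-AtomisticToContinuum-13315 · support · rank 9 · open · by planner
sources: Dafermos1979, BrenierDeLellisSzekelyhidi2011, Dafermos2005
[support] the pre-shock glue FluxClosureL2 → EntropyProductionSign → BlockSupBound → NoFastMode →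
PreShockBurgersRung: limit Young measures are measure-valued solutions of Burgers with the single
convex entropy inequality from s = 0 (crux 3 (ii)); relative entropy ∫⟨ν, (λ − w)²/2⟩ against the
classical solution is Gronwall-controlled by ‖∂_ξ w‖_∞ (Dafermos1979 /
BrenierDeLellisSzekelyhidi2011 for one convex entropy) ⇒ ν = δ_w pre-shock ⇒ convergence in
probability; no compensated compactness, no Oleinik selection needed here. [difficulty: M] -/
@[route_item "route-AtomisticToContinuum-BurgersZoomLadder"]
def PreShockAssembly : Prop :=
  FluxClosureL2 → EntropyProductionSign → BlockSupBound → NoFastMode → PreShockBurgersRung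

/-- item stmt-AtomisticToContinuum-13316 · assembly · rank 1 · open · by planner
sources: Spohn1991, OllaVaradhanYau1993
[assembly] ZoomUniformLimit → HydrodynamicLimit (specialisation to the corner δ_N ≡ 1, t_N ≡ t). -/
@[route_item "route-AtomisticToContinuum-BurgersZoomLadder"]
def Assembly : Prop :=
  ZoomUniformLimit → _root_.HydrodynamicLimit

/-! D-0027 §2.1 — DECIDING THEOREM (planner-authored via `route open/edit --closes-file`; by planner-plancard-AtomisticToContinuum-Hydrody-1b159c31-g2-0 2026-08-15T19:01:08Z):
its hypotheses are this route's items and its conclusion the sub-problem Statement (glue_lint), and it elaborates with this file. -/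

@[closes "route-AtomisticToContinuum-BurgersZoomLadder"] theorem closes : ZoomUniformLimit → _root_.HydrodynamicLimit := by
  intro H a₀ θ₀ u₀ ha hθ hu ha0 hθ0
  obtain ⟨σ₀, hσ₀, H1⟩ := H a₀ θ₀ u₀ ha hθ hu ha0 hθ0 1 one_pos (1 / 4) (by norm_num) (by norm_num)
  refine ⟨σ₀, hσ₀, ?_⟩
  intro σ hσ hσ' T ρ θ u hE Φ h0 t ht
  have hδ : ∀ N : ℕ, ((N : ℝ) + 1) ^ (-(1 / 4 : ℝ)) ≤ (fun _ : ℕ => (1 : ℝ)) N ∧ (fun _ : ℕ => (1 : ℝ)) N ≤ 1 :=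
    fun N => ⟨Real.rpow_le_one_of_one_le_of_nonpos (by norm_cast; omega) (by norm_num), le_rfl⟩
  have key := H1 σ hσ hσ' (t + 1) (by linarith [ht.1]) (fun _ => T) (fun _ => ρ) (fun _ => θ) (fun _ => u)
    (fun _ _ => hE) Φ (fun _ => (1 : ℝ)) hδ
  dsimp only at key
  simp only [Real.rpow_one, one_smul, sub_self, Real.rpow_zero, one_mul, mul_one] at key
  exact key (fun _ => h0) h0 (fun _ => t) (fun _ => ⟨ht.1, ht.2, (lt_add_one t).le⟩)

end Summit.AtomisticToContinuum.HydrodynamicLimit.Theses.BurgersZoomLadder
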